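import Summits.AtomisticToContinuum.Crystallization.Theorems.ChargedEnergyGapChartDialN

/-!
# `ChargedEnergyGap` · the CHART DIAL, part O: THE SHAPE HYPOTHESIS AS A FINITE-DIMENSIONAL STATEMENT
(decomp-a2c lens-3 g39 node «ChargeFreeGap», translation beneath hypothesis 3)

After part N, hypothesis 3 of the line of record beneath `ChartedChargePricing (3/20)` is `ChargeFreeShaped (3/20)`:
the bond dozen of every `(1/100)`-charge-free point of every periodic configuration, read in the frame of part E, is
`(3/20)`-close to a rotated kissing pattern.  This part types the LOCAL DOZEN CONSTRAINTS that such a frame reading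
provably satisfies and files the SOUND REDUCTION to a closed statement about `(ℝ³)¹² × ℝ¹²` — the statement an
adversarial census (I-CHART(b″)) samples and an interval-arithmetic certificate would prove:

* `IsLocalDozen t ρ` (`t : Fin 12 → E3` the frame positions, `ρ : Fin 12 → ℝ` the neighbours' own scales in units of
  `nn(p)`): radii `1 ≤ ‖t i‖ ≤ 101/100`, scales `ρ i ≤ ‖t i‖ ≤ (1 + 1/100)·ρ i`, separation `ρ i ≤ dist (t i) (t j)`,
  and the FOUR-RING CONSTRAINT: for every `i` exactly four `j ≠ i` have
  `dist (t i) (t j) ≤ (1 + 1/100)·ρ i ∧ dist (t i) (t j) ≤ (1 + 1/100)·ρ j` (the bond relation read in the frame).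
* `TwelveShellShaped θ`: every local dozen admits a rotated kissing pattern (fcc or hcp), and a bijective labelling
  `Fin 12 ≃` its twelve points, moving each `t i` by at most `θ`.
* **`chargeFreeShaped_of_twelveShellShaped : TwelveShellShaped θ → ChargeFreeShaped θ`** (every `θ`): the bond dozen
  of a charge-free point, enumerated by `Fin 12` and read in the frame, IS a local dozen (`isLocalDozen_of_chargeFree`,
  via `adj_iff_frame`: the bond relation between two bond neighbours of `p` is exactly the frame inequality pair), and
  a labelled matching of it is an `EtaMatched` chart of `bondShellSet Q p`.
* The line of record on the finite statement: `chartedChargePricing_of_far_cleanApproachHarnack_twelve` (`θ ≤ 3/20`).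

The reduction is one-directional by design (the local dozen forgets the rest of the configuration: realisability of a
local dozen inside a periodic charge-free environment is not claimed); it loses nothing the census measures (the
jitterbug floor `≈ 0·1004` is attained by realisable dozens).  No `sorry`, no new axiom, no instance / notation /
option.  New definitions: `IsLocalDozen`, `TwelveShellShaped` (both `Prop`-valued).
-/

noncomputable section

open Literature.MathematicalPhysics.StatisticalMechanics
open Literature.Geometry.DiscreteGeometry
open Summit.AtomisticToContinuum.Crystallization.Theses.PricedLinkCensus
open Summit.AtomisticToContinuum.Crystallization.Theorems.ChargedEnergyGapNegative
open RealInnerProductSpace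

namespace Summit.AtomisticToContinuum.Crystallization.Theorems.ChargedEnergyGapChartDial

/-! ## §1 The local dozen and the finite shape statement -/

/-- **Local dozen constraints** on twelve frame positions `t i` and twelve scales `ρ i` (the neighbours' own
nearest-neighbour distances in units of `nn(p)`): shell radii, scale comparison, separation, and the four-ring
constraint (exactly four frame-bonds at every vertex). -/
def IsLocalDozen (t : Fin 12 → E3) (ρ : Fin 12 → ℝ) : Prop :=
  (∀ i, 1 ≤ ‖t i‖ ∧ ‖t i‖ ≤ 101 / 100 ∧ ρ i ≤ ‖t i‖ ∧ ‖t i‖ ≤ (1 + 1 / 100) * ρ i) ∧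
  (∀ i j, i ≠ j → ρ i ≤ dist (t i) (t j)) ∧
  (∀ i, {j : Fin 12 | j ≠ i ∧ dist (t i) (t j) ≤ (1 + 1 / 100) * ρ i ∧
    dist (t i) (t j) ≤ (1 + 1 / 100) * ρ j}.ncard = 4)

/-- **`TwelveShellShaped θ`** — the finite-dimensional SHAPE statement: every local dozen is `θ`-close, under some
bijective labelling, to the cuboctahedral or the anticuboctahedral kissing pattern after a linear isometry. -/
def TwelveShellShaped (θ : ℝ) : Prop :=
  ∀ (t : Fin 12 → E3) (ρ : Fin 12 → ℝ), IsLocalDozen t ρ →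
    ∃ P : Finset E3, (P = fccKissingPattern ∨ P = hcpKissingPattern) ∧
      ∃ (A : E3 →ₗᵢ[ℝ] E3) (e : Fin 12 ≃ ↥(P.image A)), ∀ i, dist (t i) (e i : E3) ≤ θ

/-- `TwelveShellShaped` is monotone in `θ`. -/
theorem twelveShellShaped_mono {θ θ' : ℝ} (h : θ ≤ θ') (hS : TwelveShellShaped θ) : TwelveShellShaped θ' := by
  intro t ρ ht
  obtain ⟨P, hP, A, e, he⟩ := hS t ρ ht
  exact ⟨P, hP, A, e, fun i => (he i).trans h⟩

/-! ## §2 The bond relation read in the frame -/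

section frame

variable (Q : PeriodicConfiguration 3)

/-- `x ≤ k·min a b ↔ x ≤ k·a ∧ x ≤ k·b` for `k ≥ 0`. -/
theorem le_mul_min_iff {k x a b : ℝ} (hk : 0 ≤ k) : x ≤ k * min a b ↔ x ≤ k * a ∧ x ≤ k * b := by
  constructor
  · intro h
    exact ⟨h.trans (mul_le_mul_of_nonneg_left (min_le_left a b) hk),
      h.trans (mul_le_mul_of_nonneg_left (min_le_right a b) hk)⟩
  · rintro ⟨ha, hb⟩
    rcases min_choice a b with h | h <;> rw [h] <;> assumption

/-- **The bond relation in the frame of `p`**: two points of `Q` are bonded iff they are distinct and their frame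
distance is at most `(1 + 1/100)` times each of their own scales (in units of `nn(p)`). -/
theorem adj_iff_frame (p : Q.points) {q q' : Q.points} :
    (bonds Q).Adj q q' ↔ q ≠ q' ∧
      dist (shellCoord Q p q) (shellCoord Q p q') ≤ (1 + 1 / 100) * ((nn Q p)⁻¹ * nn Q q) ∧
      dist (shellCoord Q p q) (shellCoord Q p q') ≤ (1 + 1 / 100) * ((nn Q p)⁻¹ * nn Q q') := by
  have hc : 0 < nn Q p := Blocks.nearestDist_pt_pos Q p
  rw [bondGraph_adj, le_mul_min_iff (by norm_num), dist_eq_nn_mul_dist_shellCoord Q p (q : E3) q']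
  have key : ∀ r : Q.points, nn Q p * dist (shellCoord Q p q) (shellCoord Q p q') ≤ (1 + 1 / 100) * nn Q r ↔
      dist (shellCoord Q p q) (shellCoord Q p q') ≤ (1 + 1 / 100) * ((nn Q p)⁻¹ * nn Q r) := by
    intro r
    rw [show (1 + 1 / 100) * ((nn Q p)⁻¹ * nn Q r) = (nn Q p)⁻¹ * ((1 + 1 / 100) * nn Q r) by ring,
      le_inv_mul_iff₀ hc]
  rw [key q, key q']

/-- A bond neighbour's own scale, in units of `nn(p)`, is at most its frame radius … -/
theorem inv_mul_nn_le_norm_shellCoord (p : Q.points) {q : Q.points} (hqp : q ≠ p) :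
    (nn Q p)⁻¹ * nn Q q ≤ ‖shellCoord Q p q‖ := by
  have hc : 0 < nn Q p := Blocks.nearestDist_pt_pos Q p
  rw [inv_mul_le_iff₀ hc, ← dist_eq_nn_mul_norm_shellCoord Q p (q : E3), dist_comm]
  exact nearestDist_le_dist (Subtype.val : Q.points → E3) hqp.symm

/-- … and at least its frame radius over `1 + 1/100` when it is bonded to `p`. -/
theorem norm_shellCoord_le_mul_nn_of_adj (p : Q.points) {q : Q.points} (h : (bonds Q).Adj p q) :
    ‖shellCoord Q p q‖ ≤ (1 + 1 / 100) * ((nn Q p)⁻¹ * nn Q q) := by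
  have h' := ((adj_iff_frame Q p).1 h).2.2
  rwa [show shellCoord Q p (p : E3) = 0 by simp [shellCoord], dist_comm, dist_zero_right] at h'

/-- The separation constraint: a point's own scale is at most its frame distance to any other point. -/
theorem inv_mul_nn_le_dist_shellCoord (p : Q.points) {q q' : Q.points} (hne : q ≠ q') :
    (nn Q p)⁻¹ * nn Q q ≤ dist (shellCoord Q p q) (shellCoord Q p q') := by
  have hc : 0 < nn Q p := Blocks.nearestDist_pt_pos Q p
  rw [inv_mul_le_iff₀ hc, ← dist_eq_nn_mul_dist_shellCoord Q p (q : E3) q']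
  exact nearestDist_le_dist (Subtype.val : Q.points → E3) hne.symm

end frame

/-! ## §3 The bond dozen of a charge-free point is a local dozen -/

section dozen

variable (Q : PeriodicConfiguration 3)

/-- **The bond dozen, enumerated, is a local dozen**: for a charge-free `p` and any bijection `σ : Fin 12 ≃ N(p)`, the
frame positions `t i = shellCoord p (σ i)` and scales `ρ i = nn(σ i)/nn(p)` satisfy `IsLocalDozen`. -/
theorem isLocalDozen_of_chargeFree {p : Q.points} (hcf : IsChargeFree (1 / 100) (Subtype.val : Q.points → E3) p)
    (σ : Fin 12 ≃ ↥((bonds Q).neighborSet p)) :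
    IsLocalDozen (fun i => shellCoord Q p (σ i)) (fun i => (nn Q p)⁻¹ * nn Q (σ i)) := by
  have hadj : ∀ i, (bonds Q).Adj p (σ i) := fun i => (σ i).2
  have hne : ∀ {i j : Fin 12}, i ≠ j → ((σ i : Q.points)) ≠ (σ j : Q.points) := fun {i j} h h' =>
    h (σ.injective (Subtype.ext h'))
  refine ⟨fun i => ?_, fun i j hij => inv_mul_nn_le_dist_shellCoord Q p (hne hij), fun i => ?_⟩
  · have h1 := norm_shellCoord_of_adj Q (hadj i)
    exact ⟨h1.1, h1.2, inv_mul_nn_le_norm_shellCoord Q p (bondGraph_adj.1 (hadj i)).1.symm,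
      norm_shellCoord_le_mul_nn_of_adj Q p (hadj i)⟩
  · -- the four-ring constraint: `j ↦ σ j` maps the frame-bond set of `i` onto `N(p) ∩ N(σ i)`
    have hring : ringNumber (1 / 100) (Subtype.val : Q.points → E3) p (σ i) = 4 := hcf.2 _ (σ i).2
    rw [ringNumber] at hring
    set S : Set (Fin 12) := {j : Fin 12 | j ≠ i ∧
      dist (shellCoord Q p (σ i)) (shellCoord Q p (σ j)) ≤ (1 + 1 / 100) * ((nn Q p)⁻¹ * nn Q (σ i)) ∧
      dist (shellCoord Q p (σ i)) (shellCoord Q p (σ j)) ≤ (1 + 1 / 100) * ((nn Q p)⁻¹ * nn Q (σ j))} with hS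
    have himage : (fun j : Fin 12 => (σ j : Q.points)) '' S =
        (bonds Q).neighborSet p ∩ (bonds Q).neighborSet (σ i) := by
      ext q
      constructor
      · rintro ⟨j, hj, rfl⟩
        refine ⟨(σ j).2, ?_⟩
        show (bonds Q).Adj (σ i) (σ j)
        exact (adj_iff_frame Q p).2 ⟨hne hj.1.symm, hj.2.1, hj.2.2⟩
      · rintro ⟨hq, hq'⟩
        refine ⟨σ.symm ⟨q, hq⟩, ?_, by simp⟩
        have hA : (bonds Q).Adj (σ i) q := hq'
        have hA' := (adj_iff_frame Q p).1 hA
        have hj : σ.symm ⟨q, hq⟩ ≠ i := by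
          intro h
          apply hA'.1
          have := congrArg (fun j => ((σ j : Q.points))) h
          simpa using this.symm
        refine ⟨hj, ?_, ?_⟩
        · simpa using hA'.2.1
        · simpa using hA'.2.2
    have hinj : Function.Injective (fun j : Fin 12 => (σ j : Q.points)) :=
      fun j j' h => σ.injective (Subtype.ext h)
    rw [← Set.ncard_image_of_injective S hinj, himage]
    exact hring

end dozen

/-! ## §4 The sound reduction and the line on the finite statement -/

section reduction

variable (Q : PeriodicConfiguration 3)

/-- **Pointwise**: at a charge-free `p`, the finite shape statement gives the bond-dozen chart. -/
theorem bondChartedAt_of_twelveShellShaped {θ : ℝ} (hS : TwelveShellShaped θ) {p : Q.points}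
    (hcf : IsChargeFree (1 / 100) (Subtype.val : Q.points → E3) p) : BondChartedAt θ Q p := by
  classical
  -- enumerate the twelve bond neighbours
  have h12 : ((bonds Q).neighborSet p).ncard = 12 := hcf.1
  have hfin : ((bonds Q).neighborSet p).Finite := Set.finite_of_ncard_ne_zero (by rw [h12]; norm_num)
  haveI := hfin.to_subtype
  have hcard : Nat.card ↥((bonds Q).neighborSet p) = 12 := by rw [Nat.card_coe_set_eq]; exact h12
  obtain ⟨σ⟩ : Nonempty (Fin 12 ≃ ↥((bonds Q).neighborSet p)) := ⟨(Finite.equivFinOfCardEq hcard).symm⟩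
  set t : Fin 12 → E3 := fun i => shellCoord Q p (σ i) with ht
  have htinj : Function.Injective t := fun i j h =>
    σ.injective (Subtype.ext (Subtype.ext (shellCoord_injective Q p h)))
  obtain ⟨P, hP, A, e, he⟩ := hS t _ (isLocalDozen_of_chargeFree Q hcf σ)
  -- the chart: `T = image of t`, matched through `Fin 12`
  refine ⟨Finset.univ.image t, ?_, ?_⟩
  · ext x
    simp only [Finset.coe_image, Finset.coe_univ, Set.image_univ, Set.mem_range, bondShellSet, Set.mem_image,
      SimpleGraph.mem_neighborSet]
    constructor
    · rintro ⟨i, rfl⟩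
      exact ⟨σ i, (σ i).2, rfl⟩
    · rintro ⟨q, hq, rfl⟩
      exact ⟨σ.symm ⟨q, hq⟩, by simp [ht]⟩
  · have hrange : ∀ x : E3, x ∈ Finset.univ.image t ↔ x ∈ Set.range t := fun x => by simp
    let e₁ : ↥(Finset.univ.image t) ≃ ↥(Set.range t) := Equiv.subtypeEquivRight hrange
    let e₂ : ↥(Set.range t) ≃ Fin 12 := (Equiv.ofInjective t htinj).symm
    have hE : EtaMatched θ (Finset.univ.image t) (P.image A) := by
      refine ⟨e₁.trans (e₂.trans e), fun x => ?_⟩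
      have hx : t (e₂ (e₁ x)) = (x : E3) := by
        show t ((Equiv.ofInjective t htinj).symm (e₁ x)) = _
        rw [Equiv.apply_ofInjective_symm htinj]
        rfl
      have := he (e₂ (e₁ x))
      rwa [hx] at this
    rcases hP with rfl | rfl
    · exact Or.inl ⟨A, hE⟩
    · exact Or.inr ⟨A, hE⟩

/-- **THE SOUND REDUCTION**: the finite-dimensional shape statement implies the SHAPE hypothesis, at every `θ`. -/
theorem chargeFreeShaped_of_twelveShellShaped {θ : ℝ} (hS : TwelveShellShaped θ) : ChargeFreeShaped θ :=
  fun Q _ hcf => bondChartedAt_of_twelveShellShaped Q hS hcf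

/-- The dictionary from the finite statement, `θ ≤ 3/20` (part N). -/
theorem chargeFreeCharted_of_twelveShellShaped {θ : ℝ} (hθ : θ ≤ 3 / 20) (hS : TwelveShellShaped θ) :
    ChargeFreeCharted θ :=
  (chargeFreeCharted_iff_shaped_of_le hθ).2 (chargeFreeShaped_of_twelveShellShaped hS)

/-- **The line beneath P on the finite statement**: for `θ ≤ 3/20`,
`FarFieldPricing θ R → CleanApproachHarnack θ R M₀ M₁ → TwelveShellShaped θ → ChartedChargePricing θ`. -/
theorem chartedChargePricing_of_far_cleanApproachHarnack_twelve {θ R M₀ M₁ : ℝ} (hθ : θ ≤ 3 / 20) (hR : 0 < R)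
    (hM₀ : 0 ≤ M₀) (hF : FarFieldPricing θ R) (hH : CleanApproachHarnack θ R M₀ M₁) (hS : TwelveShellShaped θ) :
    ChartedChargePricing θ :=
  chartedChargePricing_of_far_cleanApproachHarnack_shaped_of_le hθ hR hM₀ hF hH
    (chargeFreeShaped_of_twelveShellShaped hS)

end reduction

end Summit.AtomisticToContinuum.Crystallization.Theorems.ChargedEnergyGapChartDial

end
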